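import Summits.AtomisticToContinuum.BoseEinsteinCondensation.Theses.BECCutLineWeakDisorder
import Summits.AtomisticToContinuum.BoseEinsteinCondensation.Theorems.BECCutLineWeakDisorderWitnessTransferRatio
import HarnessLib

/-!
# Route `BECCutLineWeakDisorder`, crux `TwoReplicaTransienceBound` (stmt-AtomisticToContinuum-9687):
# vocabulary and stub statements of the line `SketchIdeator1` (tracer decoupling)

Route-posited objects (D-0016 `<Route>Defs` file; precedents `BECConjugateDominationDefs.lean`,
`BECThomsonPrincipleDefs.lean`) shared by the registered stubs of the checked skeleton
`Cruxes/TwoReplicaTransienceBound/Lines/SketchIdeator1.lean` (idea card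
`Cruxes/TwoReplicaTransienceBound/Ideas/tracer-decoupling.md`, ideator sketch
`Cruxes/TwoReplicaTransienceBound/SketchIdeator1.lean`) and by the crux file that composes them.
NOTHING IS ASSERTED here: the three objects `wienerLine`, `taggedBathAction`, `tracer` are honest
definitions over `GroundStateFeynmanKac*.lean`, and every `def … : Prop` below is a *statement* (a stub
signature), consumed only as the type of a stub theorem or as a hypothesis of the sorry-free
composition `TwoReplicaTransienceBound_of` (= `stub_tracerCompose` below).

**The crux** (`Theses/BECCutLineWeakDisorder.lean`, `def TwoReplicaTransienceBound`): for admissible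
`v`, small `ρ`, some `C`, eventually in `n` and for all `T ≥ 1`,
`∫ L³ m_T(Y)²/s_T(Y)² dY ≤ C` for the finite-`T` Feynman–Kac witnesses
`Ψ_T = fkWitness (N := n+1) v L T 1 = Z_T/‖Z_T‖₂`, `Z_T = fkPartition v L T` (`L = sideLength ρ (n+1)`,
`m_T(Y) = ∫Ψ_T(x::Y)²dx`, `s_T(Y) = ∫Ψ_T(x::Y)dx`).

**The line (passive-tracer decoupling).** Split the `(n+1)`-line Feynman–Kac weight from the slice
`x :: Y` into the bath's own weight `fkWeight v L T Y ωb` and the tagged factor (tagged survival ×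
`e^{-(tagged–bath action)}`), and integrate the tagged Brownian coordinates first:
`Z_T(x::Y) = ∫ fkWeight(Y,ωb) · tracer(x,Y,ωb) dW_n(ωb)` (`Factorisation`), where `tracer` is the
survival functional of ONE passive Brownian tracer among the FROZEN bath trajectories `ωb`. Cauchy–Schwarz
in `L²(fkWeight dW_n)` and Tonelli (`Decoupling`, using `TracerMeasurable`) give, slice by slice,
`m(Y) = ∫ₓ Z_T(x::Y)² ≤ Z_n(Y) · ∫ fkWeight(Y,ωb) ∫ₓ tracer(x,Y,ωb)² dW_n`, whence the crux's integrand
`L³m²/s²` is at most `L³ m · [Z_n ∫ w ∫ₓ tracer²] / s²`; after the normalisation `Ψ_T = Z_T/‖Z_T‖₂`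
(`CutLineWitness.lintegral_ratio_const_mul`) the crux follows from ONE engine statement,
`TracerSecondMoment` — the annealed participation ratio of the passive tracer, in the crux's own slice
weighting, is `≤ C ‖Z_T‖₂²` eventually in `n`, uniformly in `T ≥ 1` (the card's transfer `C⁺`, where the
open content lives: bounded static density response of the bath and closure of the bath-field
cumulants along two Brownian tubes; cards `static-response-recoil`, `cut-covariance-static-response`).

References: the idea card `tracer-decoupling.md` (this crux); E. Bolthausen, CMP 123 (1989) 529–534
(second moment via two independent copies); F. Comets, N. Yoshida, CMP 254 (2005) 257–287 (Brownian
directed polymer in a random environment, `L²` region); K. L. Chung, Z. Zhao, *From Brownian Motion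
to Schrödinger's Equation* (1995) §3.2–3.3 (Feynman–Kac functional of killed Brownian motion).
-/

noncomputable section

namespace Summit.AtomisticToContinuum.BoseEinsteinCondensation.Cruxes.TwoReplicaTransienceBound.TracerDecoupling

open MeasureTheory Filter Set
open scoped ENNReal NNReal Topology BigOperators
open Literature.MathematicalPhysics.QuantumManyBody.BoseGas
open Literature.Probability.Process (preWienerMeasure)

variable {n : ℕ}

/-! ### Objects -/

/-- The law of the three Brownian coordinates of ONE world-line: the product of three copies of
the pre-Wiener measure (so that `wienerPaths (n+1) ≅ wienerLine ⊗ wienerPaths n` under `Fin.cons`,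
cf. `wienerPaths N = ⨂_{Fin N} ⨂_{Fin 3} preWienerMeasure`). -/
def wienerLine : Measure (Fin 3 → (ℝ≥0 → ℝ)) :=
  Measure.pi fun _ : Fin 3 => preWienerMeasure

/-- The **tagged–bath interaction action** `∫₀ᵀ ∑ⱼ v(|B⁰_s − Bʲ_s|) ds ∈ [0, ∞]` of the `(n+1)`-line
system started at the slice `x :: Y`, along tagged Brownian coordinates `ω₀` (line `0`, started at
`x`) and bath coordinates `ωb` (lines `1, …, n`, started at `Y`): the cross part of the interaction
action, `pathAction v T (x::Y) (Fin.cons ω₀ ωb) = pathAction v T Y ωb + taggedBathAction …`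
(no `v`-dependence of the tagged line on itself; the bath–bath part stays in `pathAction v T Y ωb`). -/
def taggedBathAction (v : ℝ → ℝ≥0∞) (T : ℝ) (x : Space) (Y : Config n)
    (ω₀ : Fin 3 → (ℝ≥0 → ℝ)) (ωb : PathSpace n) : ℝ≥0∞ :=
  ∫⁻ s in Set.Ioc (0 : ℝ) T, ∑ j : Fin n,
    v (dist (worldLine (Matrix.vecCons x Y) (Fin.cons ω₀ ωb) s.toNNReal 0)
      (worldLine (Matrix.vecCons x Y) (Fin.cons ω₀ ωb) s.toNNReal j.succ))

/-- The **passive-tracer survival functional**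
`tracer v L T x Y ωb = E_{ω₀}[𝟙{x + √2 b(ω₀) stays in Λ_L on [0,T]} · exp(−∫₀ᵀ ∑ⱼ v(|B⁰_s − Bʲ_s|) ds)]`:
ONE Brownian line from `x`, killed on `∂Λ_L`, weighted by its interaction with the FROZEN bath
trajectories `ωb` started at `Y`; the bath does not react (the tagged survival event is written through
the one-line instance `survives (N := 1)` of the tree's Dirichlet survival event). -/
def tracer (v : ℝ → ℝ≥0∞) (L T : ℝ) (x : Space) (Y : Config n) (ωb : PathSpace n) : ℝ≥0∞ :=
  ∫⁻ ω₀, (survives (N := 1) L T (fun _ => x)).indicator (fun _ => (1 : ℝ≥0∞)) (fun _ => ω₀) *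
      expNeg (taggedBathAction v T x Y ω₀ ωb) ∂wienerLine

/-- `wienerLine` is a probability measure (finite product of probability measures). -/
instance isProbabilityMeasure_wienerLine : IsProbabilityMeasure wienerLine := by
  haveI := Literature.Probability.RandomPlanarGeometry.isProbabilityMeasure_preWienerMeasure'
  unfold wienerLine
  infer_instance

/-- Unfolding `tracer`. -/
theorem tracer_def (v : ℝ → ℝ≥0∞) (L T : ℝ) (x : Space) (Y : Config n) (ωb : PathSpace n) :
    tracer v L T x Y ωb =
      ∫⁻ ω₀, (survives (N := 1) L T (fun _ => x)).indicator (fun _ => (1 : ℝ≥0∞)) (fun _ => ω₀) *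
        expNeg (taggedBathAction v T x Y ω₀ ωb) ∂wienerLine := rfl

/-- The tracer functional is at most `1` (indicator `≤ 1`, `e^{-a} ≤ 1`, probability reference
measure). -/
theorem tracer_le_one (v : ℝ → ℝ≥0∞) (L T : ℝ) (x : Space) (Y : Config n) (ωb : PathSpace n) :
    tracer v L T x Y ωb ≤ 1 := by
  unfold tracer
  calc ∫⁻ ω₀, (survives (N := 1) L T (fun _ => x)).indicator (fun _ => (1 : ℝ≥0∞)) (fun _ => ω₀) *
        expNeg (taggedBathAction v T x Y ω₀ ωb) ∂wienerLine
      ≤ ∫⁻ _ω₀, 1 ∂wienerLine := lintegral_mono fun ω₀ => by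
        calc (survives (N := 1) L T (fun _ => x)).indicator (fun _ => (1 : ℝ≥0∞)) (fun _ => ω₀) *
              expNeg (taggedBathAction v T x Y ω₀ ωb)
            ≤ 1 * 1 := mul_le_mul' (Set.indicator_le_self' (fun _ _ => bot_le) _) (expNeg_le_one _)
          _ = 1 := one_mul _
    _ = 1 := by rw [lintegral_const, measure_univ, mul_one]

/-! ### Stub statements of the line (signatures; nothing asserted) -/

/-- STUB `stub_factorisation` — **factorisation of the partition function through the tracer**:
for measurable `v` and all `L, T, x, Y`,
`Z_T(x::Y) = ∫ fkWeight v L T Y ωb · tracer v L T x Y ωb dW_n(ωb)`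
(`wienerPaths (n+1) = map Fin.cons (wienerLine ⊗ wienerPaths n)` by
`MeasureTheory.measurePreserving_piFinSuccAbove`; the survival event of `x::Y` is the tagged one
intersected with the bath's; `interaction v (x'::Y') = interaction v Y' + ∑ⱼ v(dist x' (Y' j))` so
`expNeg_add` splits the weight; Tonelli). -/
def Factorisation : Prop :=
  ∀ (n : ℕ) (v : ℝ → ℝ≥0∞), Measurable v → ∀ (L T : ℝ) (x : Space) (Y : Config n),
    fkPartition v L T (Matrix.vecCons x Y) =
      ∫⁻ ωb, fkWeight v L T Y ωb * tracer v L T x Y ωb ∂wienerPaths n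

/-- STUB `stub_tracerMeasurable` — **joint measurability of the tracer functional** in the tagged
starting point and the bath sample, `(x, ωb) ↦ tracer v L T x Y ωb` (measurability of the
tagged–bath action in `(x, ω₀, ωb)` through `measurable_worldLine_uncurry`-type joint measurability of
the world-lines, of the one-line survival event, and `Measurable.lintegral_prod_right'`). -/
def TracerMeasurable : Prop :=
  ∀ (n : ℕ) (v : ℝ → ℝ≥0∞), Measurable v → ∀ (L T : ℝ) (Y : Config n),
    Measurable fun p : Space × PathSpace n => tracer v L T p.1 Y p.2

/-- STUB `stub_decoupling` — **passive-tracer decoupling (Cauchy–Schwarz/Tonelli form)**: given the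
factorisation of `Z_T(·::Y)` through the tracer and the joint measurability of the tracer functional,
`∫ₓ Z_T(x::Y)² dx ≤ Z_n(Y) · ∫ fkWeight v L T Y ωb (∫ₓ tracer(x,Y,ωb)² dx) dW_n(ωb)`
(pointwise in `x`: `(∫ w g)² ≤ (∫ w)(∫ w g²)`, Hölder in the sub-probability measure
`fkPathMeasure v L T Y`; then Tonelli in `(x, ωb)`). The bath law `fkWeight dW_n/Z_n(Y)` does not
depend on `x`: the back-reaction of the tagged line on the bath is removed by an inequality. -/
def Decoupling : Prop :=
  ∀ (n : ℕ) (v : ℝ → ℝ≥0∞), Measurable v → ∀ (L T : ℝ) (Y : Config n),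
    (∀ x : Space, fkPartition v L T (Matrix.vecCons x Y) =
      ∫⁻ ωb, fkWeight v L T Y ωb * tracer v L T x Y ωb ∂wienerPaths n) →
    (Measurable fun p : Space × PathSpace n => tracer v L T p.1 Y p.2) →
    ∫⁻ x, fkPartition v L T (Matrix.vecCons x Y) ^ 2 ≤
      fkPartition v L T Y *
        ∫⁻ ωb, fkWeight v L T Y ωb * (∫⁻ x, tracer v L T x Y ωb ^ 2) ∂wienerPaths n

/-- STUB `stub_tracerSecondMoment` — the **ENGINE** (the card's transfer `C⁺`, open): for admissible
`v`, small `ρ`, some `C`, eventually in `n` and for all `T ≥ 1`, with `L = sideLength ρ (n+1)`,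
`Z = fkPartition v L T`,
`∫ L³ · m(Y) · [Z_n(Y) ∫ fkWeight(Y,ωb) ∫ₓ tracer(x,Y,ωb)² dW_n] / s(Y)² dY ≤ C · ‖Z‖₂²`
(`m(Y) = ∫ₓ Z(x::Y)²`, `s(Y) = ∫ₓ Z(x::Y)`), i.e. in the slice law `Q_T(dY) = m(Y)dY/‖Z‖₂²` the
annealed participation ratio `L³ E_μ[∫ₓ g²]/(E_μ ∫ₓ g)²` of the passive tracer `g` among the bath's own
killed, interacting world-lines (`μ_Y = fkWeight dW_n / Z_n(Y)`) has bounded mean — Bolthausen's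
second moment of ONE Brownian directed polymer in the autonomous space-time field of the bath. Free
gas: equality with the crux (`= r(T/L²)³ ↑ (π²/8)³`); ideal/diffusive bath: divergent (infinite
compressibility); interacting dilute bath: expected `R_profile + O(√(ρa³))` from bounded static
response (card `static-response-recoil`). -/
def TracerSecondMoment : Prop :=
  ∀ v : ℝ → ℝ≥0∞, IsRepulsiveFiniteRange v → ∃ ρ₀ : ℝ, 0 < ρ₀ ∧ ∀ ρ : ℝ, 0 < ρ → ρ < ρ₀ →
    ∃ C : ℝ, 0 < C ∧ ∀ᶠ n : ℕ in Filter.atTop, ∀ T : ℝ, 1 ≤ T →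
      ∫⁻ Y : Config n, ENNReal.ofReal (sideLength ρ (n + 1) ^ 3) *
          ((∫⁻ x, fkPartition v (sideLength ρ (n + 1)) T (Matrix.vecCons x Y) ^ 2) *
            (fkPartition v (sideLength ρ (n + 1)) T Y *
              ∫⁻ ωb, fkWeight v (sideLength ρ (n + 1)) T Y ωb *
                (∫⁻ x, tracer v (sideLength ρ (n + 1)) T x Y ωb ^ 2) ∂wienerPaths n)) /
            (∫⁻ x, fkPartition v (sideLength ρ (n + 1)) T (Matrix.vecCons x Y)) ^ 2 ≤
        ENNReal.ofReal C *
          fkNormSq (N := n + 1) v (sideLength ρ (n + 1)) T (fun _ => (1 : ℝ≥0∞))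

/-! ### Audit aliases (= the registered stub signatures, textually) -/

namespace Goal

/-- Registered stub `stub_factorisation`. -/
abbrev stub_factorisation : Prop := Factorisation

/-- Registered stub `stub_tracerMeasurable`. -/
abbrev stub_tracerMeasurable : Prop := TracerMeasurable

/-- Registered stub `stub_decoupling`. -/
abbrev stub_decoupling : Prop := Decoupling

/-- Registered stub `stub_tracerSecondMoment` (the engine). -/
abbrev stub_tracerSecondMoment : Prop := TracerSecondMoment

/-- Registered bookkeeping stub `stub_tracerCompose`: the four stub statements imply the crux
`TwoReplicaTransienceBound` BY NAME (proved below as `stub_tracerCompose`; registered so that this shared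
vocabulary file lands as a `--supports` file, precedents `BECConjugateDominationDefs.stub_imuOfParts`,
`BECThomsonPrincipleDefs.stub_compose`). -/
abbrev stub_tracerCompose : Prop :=
  stub_factorisation → stub_tracerMeasurable → stub_decoupling → stub_tracerSecondMoment →
    Summit.AtomisticToContinuum.BoseEinsteinCondensation.Theses.BECCutLineWeakDisorder.TwoReplicaTransienceBound

end Goal

/-! ### The composition (normalisation bookkeeping), proved -/

/-- A finite `[0, ∞]` number read back from its real part: `‖a.toReal‖₊ = a` for `a ≠ ∞`. -/
theorem coe_nnnorm_toReal {a : ℝ≥0∞} (ha : a ≠ ⊤) : (‖a.toReal‖₊ : ℝ≥0∞) = a := by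
  rw [← enorm_eq_nnnorm, Real.enorm_of_nonneg ENNReal.toReal_nonneg, ENNReal.ofReal_toReal ha]

/-- The partition function is finite (it is at most `1`). -/
theorem fkPartition_ne_top (v : ℝ → ℝ≥0∞) (L T : ℝ) {N : ℕ} (X : Config N) :
    fkPartition v L T X ≠ ⊤ :=
  ne_top_of_le_ne_top ENNReal.one_ne_top (fkPartition_le_one v L T X)

/-- The finite-`T` witness with flat datum is the real part of the partition function scaled by
`(√‖Z_T‖₂²)⁻¹`: `Ψ_T(X) = (√𝒩.toReal)⁻¹ · Z_T(X).toReal`. -/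
theorem fkWitness_one_eq (v : ℝ → ℝ≥0∞) (L T : ℝ) {N : ℕ} (X : Config N) :
    fkWitness (N := N) v L T (fun _ => (1 : ℝ≥0∞)) X =
      (Real.sqrt (fkNormSq (N := N) v L T (fun _ => (1 : ℝ≥0∞))).toReal)⁻¹ *
        (fkPartition v L T X).toReal := by
  rw [fkWitness_apply, div_eq_inv_mul]
  rfl

/-- **Composition of the line** (`stub_tracerCompose`, sorry-free): factorisation, measurability and
decoupling bound the crux's integrand slice by slice by the engine's integrand divided by `‖Z_T‖₂²`
(normalisation `Ψ_T = Z_T/‖Z_T‖₂`, `CutLineWitness.lintegral_ratio_const_mul`); the engine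
`TracerSecondMoment` then gives `TwoReplicaTransienceBound` with the same `ρ₀` and `C`. The
degenerate normalisation `‖Z_T‖₂² ∈ {0, ∞}` makes `Ψ_T ≡ 0` and the crux's integral `0`. -/
theorem stub_tracerCompose : Goal.stub_tracerCompose := by
  intro hF hM hD hE v hv
  obtain ⟨ρ₀, hρ₀, H⟩ := hE v hv
  refine ⟨ρ₀, hρ₀, fun ρ hρ hρlt => ?_⟩
  obtain ⟨C, hC, hev⟩ := H ρ hρ hρlt
  refine ⟨C, hC, ?_⟩
  filter_upwards [hev] with n hn T hT
  have hvm : Measurable v := hv.1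
  set L : ℝ := sideLength ρ (n + 1) with hL
  set 𝒩 : ℝ≥0∞ := fkNormSq (N := n + 1) v L T (fun _ => (1 : ℝ≥0∞)) with h𝒩
  set c : ℝ := (Real.sqrt 𝒩.toReal)⁻¹ with hc
  -- the witness is `c · Z_T.toReal`
  have hΨ : ∀ X, fkWitness (N := n + 1) v L T (fun _ => (1 : ℝ≥0∞)) X =
      c * (fkPartition v L T X).toReal := fun X => fkWitness_one_eq v L T X
  by_cases hc0 : c = 0
  · -- degenerate normalisation `‖Z_T‖₂² ∈ {0, ∞}`: `Ψ_T ≡ 0`, the integral vanishes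
    have h0 : ∀ X, fkWitness (N := n + 1) v L T (fun _ => (1 : ℝ≥0∞)) X = 0 := fun X => by
      rw [hΨ X, hc0, zero_mul]
    simp [h0]
  -- non-degenerate normalisation: `c ≠ 0`, `0 < ‖Z_T‖₂² < ∞`
  have hsqrt : Real.sqrt 𝒩.toReal ≠ 0 := fun h => hc0 (by rw [hc, h, inv_zero])
  have htR : 0 < 𝒩.toReal := by
    by_contra h
    exact hsqrt (Real.sqrt_eq_zero'.2 (not_lt.1 h))
  have h𝒩0 : 𝒩 ≠ 0 := fun h => htR.ne' (by rw [h, ENNReal.toReal_zero])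
  have h𝒩top : 𝒩 ≠ ⊤ := fun h => htR.ne' (by rw [h, ENNReal.toReal_top])
  have hc𝒩 : ENNReal.ofReal (c ^ 2) * 𝒩 = 1 := by
    have hc2 : c ^ 2 = (𝒩.toReal)⁻¹ := by
      rw [hc, inv_pow, Real.sq_sqrt htR.le]
    rw [hc2, ENNReal.ofReal_inv_of_pos htR, ENNReal.ofReal_toReal h𝒩top,
      ENNReal.inv_mul_cancel h𝒩0 h𝒩top]
  -- `‖Z.toReal‖₊ = Z`
  have hnn : ∀ X : Config (n + 1), (‖(fkPartition v L T X).toReal‖₊ : ℝ≥0∞) = fkPartition v L T X :=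
    fun X => coe_nnnorm_toReal (fkPartition_ne_top v L T X)
  -- slice-by-slice decoupling `m(Y) ≤ Z_n(Y) ∫ w ∫ₓ tracer²`
  have hdec : ∀ Y : Config n, ∫⁻ x, fkPartition v L T (Matrix.vecCons x Y) ^ 2 ≤
      fkPartition v L T Y *
        ∫⁻ ωb, fkWeight v L T Y ωb * (∫⁻ x, tracer v L T x Y ωb ^ 2) ∂wienerPaths n :=
    fun Y => hD n v hvm L T Y (fun x => hF n v hvm L T x Y) (hM n v hvm L T Y)
  have hmono : ∫⁻ Y : Config n, ENNReal.ofReal (L ^ 3) *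
        (∫⁻ x, fkPartition v L T (Matrix.vecCons x Y) ^ 2) ^ 2 /
          (∫⁻ x, fkPartition v L T (Matrix.vecCons x Y)) ^ 2 ≤
      ∫⁻ Y : Config n, ENNReal.ofReal (L ^ 3) *
        ((∫⁻ x, fkPartition v L T (Matrix.vecCons x Y) ^ 2) *
          (fkPartition v L T Y *
            ∫⁻ ωb, fkWeight v L T Y ωb * (∫⁻ x, tracer v L T x Y ωb ^ 2) ∂wienerPaths n)) /
          (∫⁻ x, fkPartition v L T (Matrix.vecCons x Y)) ^ 2 := by
    refine lintegral_mono fun Y => ?_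
    refine ENNReal.div_le_div_right (mul_le_mul' le_rfl ?_) _
    rw [sq]
    exact mul_le_mul' le_rfl (hdec Y)
  simp_rw [hΨ]
  rw [Theorems.CutLineWitness.lintegral_ratio_const_mul L (fun X => (fkPartition v L T X).toReal) hc0]
  simp_rw [hnn]
  calc ENNReal.ofReal (c ^ 2) * ∫⁻ Y : Config n, ENNReal.ofReal (L ^ 3) *
        (∫⁻ x, fkPartition v L T (Matrix.vecCons x Y) ^ 2) ^ 2 /
          (∫⁻ x, fkPartition v L T (Matrix.vecCons x Y)) ^ 2
      ≤ ENNReal.ofReal (c ^ 2) * (ENNReal.ofReal C * 𝒩) :=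
        mul_le_mul' le_rfl (hmono.trans (hn T hT))
    _ = ENNReal.ofReal C * (ENNReal.ofReal (c ^ 2) * 𝒩) := by ring
    _ = ENNReal.ofReal C := by rw [hc𝒩, mul_one]

/-! ### Reshape (lead, cycle 1): the QUENCHED profile form of the engine
`TracerSecondMoment` (annealed form) is FALSE as a `∀ T ≥ 1` statement at fixed `(n, L)` (the bath-path
variance of the total tracer mass `G = ∫ₓ g` grows linearly in `T`; crux workfile
`Negative-notes/annealed-tracer-second-moment.md`); that common factor cancels in the crux's ratio.
Repair: Cauchy–Schwarz with weights `w·G` (`ProfileDecoupling`) leaves the QUENCHED participation ratio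
`L³∫ₓg²/(∫ₓg)²` of the tracer profile for a fixed bath path (`TracerProfileBound`). -/
/-- STUB `stub_profileDecoupling` — **profile decoupling**: given factorisation and measurability,
`∫ₓ Z(x::Y)² ≤ s(Y) · ∫ w(Y,ωb) (∫ₓ g² / ∫ₓ g) dW_n` (Cauchy–Schwarz pointwise in `x` with weights
`w(ωb)·∫ₓg(·,ωb)`, Tonelli; `0/0 = 0` is consistent since `∫ₓ g = 0` forces `∫ₓ g² = 0`). -/
def ProfileDecoupling : Prop :=
  ∀ (n : ℕ) (v : ℝ → ℝ≥0∞), Measurable v → ∀ (L T : ℝ) (Y : Config n),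
    (∀ x : Space, fkPartition v L T (Matrix.vecCons x Y) =
      ∫⁻ ωb, fkWeight v L T Y ωb * tracer v L T x Y ωb ∂wienerPaths n) →
    (Measurable fun p : Space × PathSpace n => tracer v L T p.1 Y p.2) →
    ∫⁻ x, fkPartition v L T (Matrix.vecCons x Y) ^ 2 ≤
      (∫⁻ x, fkPartition v L T (Matrix.vecCons x Y)) *
        ∫⁻ ωb, fkWeight v L T Y ωb *
          ((∫⁻ x, tracer v L T x Y ωb ^ 2) / ∫⁻ x, tracer v L T x Y ωb) ∂wienerPaths n

/-- STUB `stub_tracerProfileBound` — the **reshaped ENGINE** (open): eventually in `n`, for all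
`T ≥ 1`: `∫ L³ · m(Y) · [∫ w(Y,ωb) (∫ₓg²/∫ₓg) dW_n] / s(Y) dY ≤ C ‖Z‖₂²`, i.e. under the joint law
"slice `Y ∼ m dY/‖Z‖₂²`, bath paths `ωb ∼ w(Y,ωb)G(ωb)dW_n/s(Y)`" (the bath seen by a uniformly started
tagged line) the quenched participation ratio `L³∫ₓg²/(∫ₓg)²` of the passive tracer's survival profile
has mean `≤ C`. Free gas: equality with the crux; fixed `(n,L)`, `T → ∞`: finite (the late-time factor
of `g` cancels); content: flatness of the quenched log-profile, second cumulant
`ρ∫d³k v̂²S(k)/(k²(k²+ε_k)) ≤ 2ρ∫d³k v̂²m₋₁(k)/k² = O(√(ρa³))` for a bath of bounded static response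
(card `static-response-recoil`), divergent for an ideal or frozen bath. -/
def TracerProfileBound : Prop :=
  ∀ v : ℝ → ℝ≥0∞, IsRepulsiveFiniteRange v → ∃ ρ₀ : ℝ, 0 < ρ₀ ∧ ∀ ρ : ℝ, 0 < ρ → ρ < ρ₀ →
    ∃ C : ℝ, 0 < C ∧ ∀ᶠ n : ℕ in Filter.atTop, ∀ T : ℝ, 1 ≤ T →
      ∫⁻ Y : Config n, ENNReal.ofReal (sideLength ρ (n + 1) ^ 3) *
          ((∫⁻ x, fkPartition v (sideLength ρ (n + 1)) T (Matrix.vecCons x Y) ^ 2) *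
            ∫⁻ ωb, fkWeight v (sideLength ρ (n + 1)) T Y ωb *
              ((∫⁻ x, tracer v (sideLength ρ (n + 1)) T x Y ωb ^ 2) /
                ∫⁻ x, tracer v (sideLength ρ (n + 1)) T x Y ωb) ∂wienerPaths n) /
            (∫⁻ x, fkPartition v (sideLength ρ (n + 1)) T (Matrix.vecCons x Y)) ≤
        ENNReal.ofReal C *
          fkNormSq (N := n + 1) v (sideLength ρ (n + 1)) T (fun _ => (1 : ℝ≥0∞))

namespace Goal
/-- Registered stub `stub_profileDecoupling`. -/
abbrev stub_profileDecoupling : Prop := ProfileDecoupling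
/-- Registered stub `stub_tracerProfileBound` (the reshaped engine). -/
abbrev stub_tracerProfileBound : Prop := TracerProfileBound
/-- Registered bookkeeping stub `stub_profileCompose` (proved below): the reshaped line ⇒ crux. -/
abbrev stub_profileCompose : Prop :=
  stub_factorisation → stub_tracerMeasurable → stub_profileDecoupling → stub_tracerProfileBound →
    Summit.AtomisticToContinuum.BoseEinsteinCondensation.Theses.BECCutLineWeakDisorder.TwoReplicaTransienceBound
end Goal

/-- `[0, ∞]` arithmetic of the reshaped composition: `m ≤ s·P ⟹ m²/s² ≤ m·P/s`. -/
theorem sq_div_sq_le_mul_div {m s P : ℝ≥0∞} (h : m ≤ s * P) : m ^ 2 / s ^ 2 ≤ m * P / s := by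
  rcases eq_or_ne s 0 with rfl | hs0
  · have hm : m = 0 := by simpa using h
    simp [hm]
  rcases eq_or_ne s ⊤ with rfl | hst
  · simp [ENNReal.div_top]
  calc m ^ 2 / s ^ 2 = m * m / (s * s) := by rw [sq, sq]
    _ ≤ m * (s * P) / (s * s) := ENNReal.div_le_div_right (mul_le_mul' le_rfl h) _
    _ = m * P * s / (s * s) := by ring_nf
    _ = m * P / s := ENNReal.mul_div_mul_right _ _ hs0 hst
/-- **Composition of the reshaped line** (`stub_profileCompose`, sorry-free): as `stub_tracerCompose`
with `ProfileDecoupling`/`TracerProfileBound` (`sq_div_sq_le_mul_div` slice by slice). -/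
theorem stub_profileCompose : Goal.stub_profileCompose := by
  intro hF hM hD hE v hv
  obtain ⟨ρ₀, hρ₀, H⟩ := hE v hv
  refine ⟨ρ₀, hρ₀, fun ρ hρ hρlt => ?_⟩
  obtain ⟨C, hC, hev⟩ := H ρ hρ hρlt
  refine ⟨C, hC, ?_⟩
  filter_upwards [hev] with n hn T hT
  have hvm : Measurable v := hv.1
  set L : ℝ := sideLength ρ (n + 1) with hL
  set 𝒩 : ℝ≥0∞ := fkNormSq (N := n + 1) v L T (fun _ => (1 : ℝ≥0∞)) with h𝒩
  set c : ℝ := (Real.sqrt 𝒩.toReal)⁻¹ with hc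
  have hΨ : ∀ X, fkWitness (N := n + 1) v L T (fun _ => (1 : ℝ≥0∞)) X =
      c * (fkPartition v L T X).toReal := fun X => fkWitness_one_eq v L T X
  by_cases hc0 : c = 0
  · have h0 : ∀ X, fkWitness (N := n + 1) v L T (fun _ => (1 : ℝ≥0∞)) X = 0 := fun X => by
      rw [hΨ X, hc0, zero_mul]
    simp [h0]
  have hsqrt : Real.sqrt 𝒩.toReal ≠ 0 := fun h => hc0 (by rw [hc, h, inv_zero])
  have htR : 0 < 𝒩.toReal := not_le.1 fun h => hsqrt (Real.sqrt_eq_zero'.2 h)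
  have h𝒩0 : 𝒩 ≠ 0 := fun h => htR.ne' (by rw [h, ENNReal.toReal_zero])
  have h𝒩top : 𝒩 ≠ ⊤ := fun h => htR.ne' (by rw [h, ENNReal.toReal_top])
  have hc𝒩 : ENNReal.ofReal (c ^ 2) * 𝒩 = 1 := by
    have hc2 : c ^ 2 = (𝒩.toReal)⁻¹ := by rw [hc, inv_pow, Real.sq_sqrt htR.le]
    rw [hc2, ENNReal.ofReal_inv_of_pos htR, ENNReal.ofReal_toReal h𝒩top,
      ENNReal.inv_mul_cancel h𝒩0 h𝒩top]
  have hnn : ∀ X : Config (n + 1), (‖(fkPartition v L T X).toReal‖₊ : ℝ≥0∞) = fkPartition v L T X :=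
    fun X => coe_nnnorm_toReal (fkPartition_ne_top v L T X)
  have hmono : ∫⁻ Y : Config n, ENNReal.ofReal (L ^ 3) *
        (∫⁻ x, fkPartition v L T (Matrix.vecCons x Y) ^ 2) ^ 2 /
          (∫⁻ x, fkPartition v L T (Matrix.vecCons x Y)) ^ 2 ≤
      ∫⁻ Y : Config n, ENNReal.ofReal (L ^ 3) *
        ((∫⁻ x, fkPartition v L T (Matrix.vecCons x Y) ^ 2) *
          ∫⁻ ωb, fkWeight v L T Y ωb *
            ((∫⁻ x, tracer v L T x Y ωb ^ 2) / ∫⁻ x, tracer v L T x Y ωb) ∂wienerPaths n) /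
          (∫⁻ x, fkPartition v L T (Matrix.vecCons x Y)) := by
    refine lintegral_mono fun Y => ?_
    rw [mul_div_assoc, mul_div_assoc]
    exact mul_le_mul' le_rfl
      (sq_div_sq_le_mul_div (hD n v hvm L T Y (fun x => hF n v hvm L T x Y) (hM n v hvm L T Y)))
  simp_rw [hΨ]
  rw [Theorems.CutLineWitness.lintegral_ratio_const_mul L (fun X => (fkPartition v L T X).toReal) hc0]
  simp_rw [hnn]
  calc ENNReal.ofReal (c ^ 2) * ∫⁻ Y : Config n, ENNReal.ofReal (L ^ 3) *
        (∫⁻ x, fkPartition v L T (Matrix.vecCons x Y) ^ 2) ^ 2 /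
          (∫⁻ x, fkPartition v L T (Matrix.vecCons x Y)) ^ 2
      ≤ ENNReal.ofReal (c ^ 2) * (ENNReal.ofReal C * 𝒩) :=
        mul_le_mul' le_rfl (hmono.trans (hn T hT))
    _ = ENNReal.ofReal C * (ENNReal.ofReal (c ^ 2) * 𝒩) := by ring
    _ = ENNReal.ofReal C := by rw [hc𝒩, mul_one]

end Summit.AtomisticToContinuum.BoseEinsteinCondensation.Cruxes.TwoReplicaTransienceBound.TracerDecoupling

end
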